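import Mathlib
import Summits.Ventures.HodgeRepro.Tier4.Target
import Summits.Ventures.HodgeRepro.Tier4.Line3.KMDatum
import Summits.Ventures.HodgeRepro.Tier4.Line3.KMDatumS
import Summits.Ventures.HodgeRepro.Tier4.Line3.Witness.PhiDel
import Summits.Ventures.HodgeRepro.Tier4.Line3.Witness.MajCoercive

/-!
# Tier4/Line3/Witness/PhiDelEquiv — the `equiv` clause for the `∂`-datum `Φ_∂` (the last clause of the R4 witness of
LINE L3's `ThetaData`)
(seat t4-L2-p2, gen 0, on t4-plan-3's word S12460 (ii); blind re-derivation cell `pub-hodge-repro`, Tier 4, README §9–§10)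

`PhiDel_equiv`: for every `J`-unitary `M`, `y ∈ ℂ³`, `z` in the ball and `l`,
`Σ_k Φ_∂(M y, M·z)_k · ∂_l (M·z)_k = Φ_∂(y, z)_l` — the clause `ThetaData.equiv` VERBATIM for `Φ := PhiDel`
(`Witness/PhiDel.lean`).  The proof is the chain rule for the holomorphic action, in three steps:

* `wd_expMaj` — `Φ_∂(y, z)_k = ∂_{z_k} e^{−π maj y z}`, where `∂_{z_k} u = ½ (D u (e_k) − i D u (i e_k))` is the
  Wirtinger derivative through the REAL Fréchet derivative (`wd`); the real derivative of `w ↦ maj y w`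
  (`hasFDerivAt_maj`: `ℓ_w(y)` is affine in `w`, `‖ℓ‖²` by `HasFDerivAt.norm_sq`, `(1 − |w|²)⁻¹` by the inverse rule)
  evaluated at `e_k` and `i e_k` reproduces `quad_Adel`;
* `wd_comp` — the Wirtinger chain rule `∂_l (u ∘ h) = Σ_k (∂_k u)(h z) · ∂_l h_k` for `h` complex-differentiable
  (`D h` is `ℂ`-linear, so `D h (i e_l) = i · D h (e_l)`; expand `D h (e_l)` along the real basis `e_k, i e_k`);
* `maj_actM'` — `maj (M y) (M·z) = maj y z` on the ball (t4-plan-3's `maj_actM`, HOME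
  proofs/t4-plan-3/L3/MajInvariance.lean, S12433, reproduced under suffixed names with credit because that module is
  not in the tree), so `e^{−π maj (M y) (M·)} = e^{−π maj y ·}` on the (open) ball, and `actM M` is holomorphic there
  (`differentiableAt_actM`, the automorphy factor `j(M, z) ≠ 0`: `j_ne_zero`).

Mathlib + the target's definitions; no printed input.  Nothing here says anything about the status of the Hodge
conjecture for CM abelian varieties, which is NOT proved (HC_CM is NOT proved by anyone in this repository).
-/

set_option autoImplicit false

noncomputable section

namespace Summit.Ventures.HodgeRepro.Tier4.Line3

open Summit.Ventures.HodgeRepro.Tier4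
open Matrix
open scoped ComplexConjugate

/-- The Wirtinger derivative `∂/∂z_l` of a function `u : ℂ² → ℂ`, through the real Fréchet derivative:
`∂_l u = ½ (D u (e_l) − i · D u (i e_l))`. -/
def wd (l : Fin 2) (u : (Fin 2 → ℂ) → ℂ) (z : Fin 2 → ℂ) : ℂ :=
  (1 / 2 : ℂ) * (fderiv ℝ u z (Pi.single l 1) - Complex.I * fderiv ℝ u z (Pi.single l Complex.I))

/-! ### The real derivative of the majorant -/

/-- The real-linear derivative of `w ↦ ℓ_w(y) = conj w₀ y₀ + conj w₁ y₁ − y₂`. -/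
def Lell (y : Fin 3 → ℂ) : (Fin 2 → ℂ) →L[ℝ] ℂ :=
  y 0 • ((Complex.conjCLE : ℂ →L[ℝ] ℂ).comp (ContinuousLinearMap.proj 0)) +
    y 1 • ((Complex.conjCLE : ℂ →L[ℝ] ℂ).comp (ContinuousLinearMap.proj 1))

/-- `Lell y v = conj v₀ y₀ + conj v₁ y₁`. -/
theorem Lell_apply (y : Fin 3 → ℂ) (v : Fin 2 → ℂ) : Lell y v = conj (v 0) * y 0 + conj (v 1) * y 1 := by
  simp [Lell, mul_comm]

/-- `ℓ_w(y)` (as `star (lift3 w) ⬝ᵥ (J *ᵥ y)`) is affine in `w` with derivative `Lell y`. -/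
theorem hasFDerivAt_ell (y : Fin 3 → ℂ) (z : Fin 2 → ℂ) :
    HasFDerivAt (fun w : Fin 2 → ℂ => star (lift3 w) ⬝ᵥ (J *ᵥ y)) (Lell y) z := by
  have h : (fun w : Fin 2 → ℂ => star (lift3 w) ⬝ᵥ (J *ᵥ y)) = fun w => Lell y w - y 2 := by
    funext w
    rw [star_lift3_dot_J, Lell_apply]
  rw [h]
  exact (Lell y).hasFDerivAt.sub_const (y 2)

/-- The real-linear derivative of `nsq`. -/
def Lnsq (z : Fin 2 → ℂ) : (Fin 2 → ℂ) →L[ℝ] ℝ :=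
  (2 : ℕ) • (innerSL ℝ (z 0)).comp (ContinuousLinearMap.proj 0) +
    (2 : ℕ) • (innerSL ℝ (z 1)).comp (ContinuousLinearMap.proj 1)

/-- The real derivative of `nsq`. -/
theorem hasFDerivAt_nsq (z : Fin 2 → ℂ) : HasFDerivAt nsq (Lnsq z) z := by
  have h0 : HasFDerivAt (fun w : Fin 2 → ℂ => w 0) (ContinuousLinearMap.proj 0 : (Fin 2 → ℂ) →L[ℝ] ℂ) z :=
    hasFDerivAt_apply 0 z
  have h1 : HasFDerivAt (fun w : Fin 2 → ℂ => w 1) (ContinuousLinearMap.proj 1 : (Fin 2 → ℂ) →L[ℝ] ℂ) z :=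
    hasFDerivAt_apply 1 z
  have := (h0.norm_sq).add (h1.norm_sq)
  unfold nsq
  exact this

/-- `Lnsq z v = 2 re(v₀ conj z₀) + 2 re(v₁ conj z₁)`. -/
theorem Lnsq_apply (z v : Fin 2 → ℂ) : Lnsq z v = 2 * (v 0 * conj (z 0)).re + 2 * (v 1 * conj (z 1)).re := by
  simp [Lnsq, Complex.inner]
  ring

/-- The real derivative of `w ↦ maj y w` at `z` in the ball. -/
theorem hasFDerivAt_maj (y : Fin 3 → ℂ) {z : Fin 2 → ℂ} (hz : z ∈ ball) :
    HasFDerivAt (fun w => maj y w)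
      ((2 : ℝ) • ((‖star (lift3 z) ⬝ᵥ (J *ᵥ y)‖ ^ 2) • (-((1 - nsq z) ^ 2)⁻¹ • (-(Lnsq z))) +
        (1 - nsq z)⁻¹ • ((2 : ℕ) • (innerSL ℝ (star (lift3 z) ⬝ᵥ (J *ᵥ y))).comp (Lell y)))) z := by
  have hne : 1 - nsq z ≠ 0 := (one_sub_nsq_pos hz).ne'
  have hN := (hasFDerivAt_ell y z).norm_sq
  have hd : HasFDerivAt (fun w => 1 - nsq w) (-(Lnsq z)) z := by
    have := (hasFDerivAt_nsq z).const_sub 1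
    simpa using this
  have hinv : HasFDerivAt (fun w => (1 - nsq w)⁻¹) (-((1 - nsq z) ^ 2)⁻¹ • (-(Lnsq z))) z :=
    (hasDerivAt_inv hne).comp_hasFDerivAt z hd
  have hG := hN.mul hinv
  have hmaj : (fun w => maj y w) =
      fun w => (star y ⬝ᵥ (J *ᵥ y)).re + 2 * (‖star (lift3 w) ⬝ᵥ (J *ᵥ y)‖ ^ 2 * (1 - nsq w)⁻¹) := by
    funext w
    unfold maj
    rw [div_eq_mul_inv, mul_assoc]
  rw [hmaj]
  have := (hG.const_mul (2 : ℝ)).const_add ((star y ⬝ᵥ (J *ᵥ y)).re)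
  exact this


/-- **The `∂`-datum is the Wirtinger derivative of the Gaussian of the majorant**: on the ball,
`Φ_∂(y, z)_k = ∂_{z_k} e^{−π maj y z}`. -/
theorem wd_expMaj (y : Fin 3 → ℂ) {z : Fin 2 → ℂ} (hz : z ∈ ball) (k : Fin 2) :
    wd k (fun w => ((Real.exp (-Real.pi * maj y w) : ℝ) : ℂ)) z = datumS PhiDel y z k := by
  have hmaj := hasFDerivAt_maj y hz
  have hexp := (hmaj.const_mul (-Real.pi)).exp
  have hC : HasFDerivAt (fun w => ((Real.exp (-Real.pi * maj y w) : ℝ) : ℂ))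
      (Complex.ofRealCLM.comp (Real.exp (-Real.pi * maj y z) • ((-Real.pi) •
        ((2 : ℝ) • ((‖star (lift3 z) ⬝ᵥ (J *ᵥ y)‖ ^ 2) • (-((1 - nsq z) ^ 2)⁻¹ • (-(Lnsq z))) +
          (1 - nsq z)⁻¹ • ((2 : ℕ) • (innerSL ℝ (star (lift3 z) ⬝ᵥ (J *ᵥ y))).comp (Lell y))))))) z :=
    Complex.ofRealCLM.hasFDerivAt.comp z hexp
  unfold wd
  rw [hC.fderiv, datumS_PhiDel]
  simp only [ContinuousLinearMap.comp_apply, _root_.smul_apply, _root_.add_apply, _root_.neg_apply, smul_eq_mul,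
    Lnsq_apply, Lell_apply, Complex.ofRealCLM_apply, nsmul_eq_mul, innerSL_apply_apply, Complex.inner, ell_eq,
    star_lift3_dot_J]
  fin_cases k <;>
  · simp only [Fin.zero_eta, Fin.mk_one, Fin.castSucc_zero, Fin.castSucc_one, Pi.single_eq_same, ne_eq,
      Fin.one_eq_zero_iff, Fin.zero_eq_one_iff, OfNat.ofNat_ne_one, not_false_eq_true,
      Pi.single_eq_of_ne, Fin.isValue]
    apply Complex.ext <;>
    simp [Complex.sq_norm, Complex.normSq_apply, Complex.mul_re, Complex.mul_im, Complex.add_re, Complex.add_im,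
      Complex.sub_re, Complex.sub_im, Complex.conj_re, Complex.conj_im] <;>
    ring


/-! ### The Wirtinger chain rule for a holomorphic inner map -/

/-- `e_l · i = i • e_l` as vectors. -/
theorem single_I_eq (l : Fin 2) : (Pi.single l Complex.I : Fin 2 → ℂ) = Complex.I • Pi.single l 1 := by
  funext j
  by_cases h : j = l
  · subst h; simp
  · simp [Pi.single_eq_of_ne h]

/-- A vector of `ℂ²` as a real combination of the `e_k` and `i e_k`. -/
theorem vec_eq_sum (w : Fin 2 → ℂ) :
    w = ∑ k, ((w k).re • (Pi.single k 1 : Fin 2 → ℂ) + (w k).im • (Pi.single k Complex.I : Fin 2 → ℂ)) := by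
  funext j
  fin_cases j <;> simp [Finset.sum_apply, Pi.single_apply, Complex.real_smul, Fin.sum_univ_two]

/-- **The Wirtinger chain rule**: for `h` complex-differentiable at `z` and `u` real-differentiable at `h z`,
`∂_l (u ∘ h) = Σ_k (∂_k u)(h z) · ∂_l h_k` (`∂_l h_k = pd l (h · k) z`, the holomorphic derivative). -/
theorem wd_comp (u : (Fin 2 → ℂ) → ℂ) (h : (Fin 2 → ℂ) → (Fin 2 → ℂ)) (z : Fin 2 → ℂ)
    (hh : DifferentiableAt ℂ h z) (hu : DifferentiableAt ℝ u (h z)) (l : Fin 2) :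
    wd l (u ∘ h) z = ∑ k, wd k u (h z) * pd l (fun w => h w k) z := by
  set D := fderiv ℂ h z with hD
  set Du := fderiv ℝ u (h z) with hDu
  have hcomp : fderiv ℝ (u ∘ h) z = Du.comp (D.restrictScalars ℝ) := by
    rw [fderiv_comp z hu (hh.restrictScalars ℝ), hh.fderiv_restrictScalars ℝ]
  set w := D (Pi.single l 1) with hw
  have hwI : D (Pi.single l Complex.I) = Complex.I • w := by
    rw [single_I_eq, map_smul]
  have hpd : ∀ k, pd l (fun w => h w k) z = w k := by
    intro k
    have hk : ∀ i, DifferentiableAt ℂ (fun w => h w i) z := fun i => (differentiableAt_pi.mp hh) i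
    have := fderiv_pi (𝕜 := ℂ) (φ := fun i w => h w i) (x := z) hk
    simp only [pd]
    have e : (fun x i => h x i) = h := rfl
    rw [e] at this
    rw [hw, hD, this, ContinuousLinearMap.pi_apply]
  -- expand `Du w` and `Du (i • w)` along the real basis
  have hDw : Du w = ∑ k, ((w k).re • Du (Pi.single k 1) + (w k).im • Du (Pi.single k Complex.I)) := by
    conv_lhs => rw [vec_eq_sum w]
    rw [map_sum]
    refine Finset.sum_congr rfl fun k _ => ?_
    rw [map_add, map_smul, map_smul]
  have hDIw : Du (Complex.I • w) =
      ∑ k, (-(w k).im • Du (Pi.single k 1) + (w k).re • Du (Pi.single k Complex.I)) := by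
    conv_lhs => rw [vec_eq_sum (Complex.I • w)]
    rw [map_sum]
    refine Finset.sum_congr rfl fun k _ => ?_
    rw [map_add, map_smul, map_smul]
    simp [Pi.smul_apply, Complex.mul_re, Complex.mul_im]
  unfold wd
  rw [hcomp]
  simp only [ContinuousLinearMap.comp_apply, ContinuousLinearMap.coe_restrictScalars']
  rw [← hw, hwI, hDw, hDIw, Finset.mul_sum, ← Finset.sum_sub_distrib, Finset.mul_sum]
  refine Finset.sum_congr rfl fun k _ => ?_
  rw [hpd]
  simp only [Complex.real_smul]
  have hk : w k = ((w k).re : ℂ) + ((w k).im : ℂ) * Complex.I := (Complex.re_add_im (w k)).symm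
  conv_rhs => rw [hk]
  rw [hDu]
  push_cast
  ring_nf
  rw [Complex.I_sq]
  ring


/-! ### The majorant is `U(J)`-invariant (t4-plan-3's `maj_actM`, HOME proofs/t4-plan-3/L3/MajInvariance.lean
b7bb8aaa29c0ef50, S12433 — reproduced here under suffixed names, with credit, because that module is not in the tree) -/

/-- The `J`-hermitian pairing `w^* J y`. -/
def hermJW (w y : Fin 3 → ℂ) : ℂ := star w ⬝ᵥ (J *ᵥ y)

/-- `w^* J w = |w₀|² + |w₁|² − |w₂|²` (real part). -/
theorem hermJW_self_re (v : Fin 3 → ℂ) : (hermJW v v).re = ‖v 0‖ ^ 2 + ‖v 1‖ ^ 2 - ‖v 2‖ ^ 2 :=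
  re_hermJ_self v

/-- `cstar starRingAut M = Mᴴ`. -/
theorem cstar_star_eq (M : Matrix (Fin 3) (Fin 3) ℂ) : cstar (starRingAut : ℂ ≃+* ℂ) M = Mᴴ := by
  ext i j
  simp [cstar, Matrix.conjTranspose_apply]

/-- The pairing is invariant under `J`-unitary matrices. -/
theorem hermJW_mulVec (M : Matrix (Fin 3) (Fin 3) ℂ) (hM : IsUnitaryOf (starRingAut : ℂ ≃+* ℂ) J M)
    (w y : Fin 3 → ℂ) : hermJW (M *ᵥ w) (M *ᵥ y) = hermJW w y := by
  unfold IsUnitaryOf at hM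
  rw [cstar_star_eq] at hM
  unfold hermJW
  rw [star_mulVec, mulVec_mulVec, ← dotProduct_mulVec, mulVec_mulVec, ← Matrix.mul_assoc, hM]

/-- Conjugate-linearity in the first slot. -/
theorem hermJW_smul_left (t : ℂ) (w y : Fin 3 → ℂ) : hermJW (t • w) y = star t * hermJW w y := by
  unfold hermJW
  rw [star_smul, smul_dotProduct, smul_eq_mul]

/-- `w_z^* J w_z = |z|² − 1`. -/
theorem hermJW_lift3_self (z : Fin 2 → ℂ) : (hermJW (lift3 z) (lift3 z)).re = nsq z - 1 := by
  rw [hermJW_self_re]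
  simp [lift3, nsq]

/-- The automorphy factor `j(M, z) = (M w_z)₂` does not vanish on the ball. -/
theorem j_ne_zero (M : Matrix (Fin 3) (Fin 3) ℂ) (hM : IsUnitaryOf (starRingAut : ℂ ≃+* ℂ) J M)
    {z : Fin 2 → ℂ} (hz : z ∈ ball) : (M *ᵥ lift3 z) 2 ≠ 0 := by
  intro h0
  have h1 := hermJW_mulVec M hM (lift3 z) (lift3 z)
  have h2 := congrArg Complex.re h1
  rw [hermJW_self_re, hermJW_lift3_self, h0] at h2
  have hz' : nsq z < 1 := hz
  simp only [norm_zero] at h2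
  nlinarith [sq_nonneg ‖(M *ᵥ lift3 z) 0‖, sq_nonneg ‖(M *ᵥ lift3 z) 1‖]

/-- `lift3 (actM M z) = j⁻¹ • (M w_z)`. -/
theorem lift3_actM' (M : Matrix (Fin 3) (Fin 3) ℂ) (z : Fin 2 → ℂ) (hj : (M *ᵥ lift3 z) 2 ≠ 0) :
    lift3 (actM M z) = ((M *ᵥ lift3 z) 2)⁻¹ • (M *ᵥ lift3 z) := by
  ext k
  fin_cases k
  · simp [lift3, actM, div_eq_inv_mul]
  · simp [lift3, actM, div_eq_inv_mul]
  · simp only [lift3, Pi.smul_apply, smul_eq_mul]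
    exact (inv_mul_cancel₀ hj).symm

/-- `1 − |M·z|² = −(M w_z)^* J (M w_z) / |j|²`. -/
theorem nsq_actM' (M : Matrix (Fin 3) (Fin 3) ℂ) (z : Fin 2 → ℂ) (hj : (M *ᵥ lift3 z) 2 ≠ 0) :
    1 - nsq (actM M z) = -(hermJW (M *ᵥ lift3 z) (M *ᵥ lift3 z)).re / ‖(M *ᵥ lift3 z) 2‖ ^ 2 := by
  have hj' : ‖(M *ᵥ lift3 z) 2‖ ^ 2 ≠ 0 := by positivity
  rw [hermJW_self_re]
  have e0 : (Fin.castSucc (0 : Fin 2) : Fin 3) = 0 := rfl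
  have e1 : (Fin.castSucc (1 : Fin 2) : Fin 3) = 1 := rfl
  simp only [nsq, actM, e0, e1]
  rw [norm_div, norm_div, div_pow, div_pow]
  field_simp
  ring

/-- **The majorant is `U(J)`-invariant on the ball** (plan-3's `maj_actM`). -/
theorem maj_actM' (M : Matrix (Fin 3) (Fin 3) ℂ) (hM : IsUnitaryOf (starRingAut : ℂ ≃+* ℂ) J M)
    (y : Fin 3 → ℂ) {z : Fin 2 → ℂ} (hz : z ∈ ball) : maj (M *ᵥ y) (actM M z) = maj y z := by
  have hj := j_ne_zero M hM hz
  have hj' : ‖(M *ᵥ lift3 z) 2‖ ^ 2 ≠ 0 := by positivity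
  have hball : 1 - nsq z ≠ 0 := by
    have : nsq z < 1 := hz
    linarith
  have hb2 : nsq z - 1 ≠ 0 := by
    have : nsq z < 1 := hz
    linarith
  unfold maj
  change (hermJW (M *ᵥ y) (M *ᵥ y)).re + 2 * ‖hermJW (lift3 (actM M z)) (M *ᵥ y)‖ ^ 2 / (1 - nsq (actM M z)) =
    (hermJW y y).re + 2 * ‖hermJW (lift3 z) y‖ ^ 2 / (1 - nsq z)
  rw [hermJW_mulVec M hM, lift3_actM' M z hj, hermJW_smul_left, hermJW_mulVec M hM, nsq_actM' M z hj,
    hermJW_mulVec M hM, hermJW_lift3_self]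
  rw [norm_mul, mul_pow, Complex.star_def, Complex.norm_conj, norm_inv, inv_pow, neg_sub]
  field_simp

/-- `M · z` stays in the ball for `J`-unitary `M`. -/
theorem actM_mem_ball' (M : Matrix (Fin 3) (Fin 3) ℂ) (hM : IsUnitaryOf (starRingAut : ℂ ≃+* ℂ) J M)
    {z : Fin 2 → ℂ} (hz : z ∈ ball) : actM M z ∈ ball := by
  have hj := j_ne_zero M hM hz
  have h1 : 1 - nsq (actM M z) = (1 - nsq z) / ‖(M *ᵥ lift3 z) 2‖ ^ 2 := by
    rw [nsq_actM' M z hj, hermJW_mulVec M hM, hermJW_lift3_self]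
    ring
  have hpos : 0 < (1 - nsq z) / ‖(M *ᵥ lift3 z) 2‖ ^ 2 := by
    have := one_sub_nsq_pos hz
    positivity
  show nsq (actM M z) < 1
  linarith

/-! ### Holomorphy of the action -/

/-- `w ↦ (M w_w)_i` is an affine function of `w`, hence complex-differentiable. -/
theorem differentiableAt_mulVec_lift3 (M : Matrix (Fin 3) (Fin 3) ℂ) (i : Fin 3) (z : Fin 2 → ℂ) :
    DifferentiableAt ℂ (fun w : Fin 2 → ℂ => (M *ᵥ lift3 w) i) z := by
  have : (fun w : Fin 2 → ℂ => (M *ᵥ lift3 w) i) = fun w => M i 0 * w 0 + M i 1 * w 1 + M i 2 := by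
    funext w
    simp [Matrix.mulVec, dotProduct, Fin.sum_univ_three, lift3]
  rw [this]
  fun_prop

/-- `actM M` is complex-differentiable where `j(M, z) ≠ 0`, in particular on the ball for `J`-unitary `M`. -/
theorem differentiableAt_actM (M : Matrix (Fin 3) (Fin 3) ℂ) {z : Fin 2 → ℂ} (hj : (M *ᵥ lift3 z) 2 ≠ 0) :
    DifferentiableAt ℂ (actM M) z := by
  refine differentiableAt_pi.mpr fun k => ?_
  have e : (fun w => actM M w k) = fun w : Fin 2 → ℂ =>
      (M (Fin.castSucc k) 0 * w 0 + M (Fin.castSucc k) 1 * w 1 + M (Fin.castSucc k) 2) /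
        (M 2 0 * w 0 + M 2 1 * w 1 + M 2 2) := by
    funext w
    simp [actM, Matrix.mulVec, dotProduct, Fin.sum_univ_three, lift3]
  have hj' : M 2 0 * z 0 + M 2 1 * z 1 + M 2 2 ≠ 0 := by
    simpa [Matrix.mulVec, dotProduct, Fin.sum_univ_three, lift3] using hj
  rw [e]
  fun_prop (disch := exact hj')

/-- The ball is open. -/
theorem isOpen_ball' : IsOpen ball := isOpen_lt continuous_nsq continuous_const

/-- **`equiv` for `Φ_∂`**: `Σ_k Φ_∂(M y, M z)_k · ∂_l (M z)_k = Φ_∂(y, z)_l` for `J`-unitary `M` and `z` in the ball —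
the Wirtinger chain rule applied to `e^{−π maj (M y) (M ·)} = e^{−π maj y ·}` near `z` (`maj_actM'`). -/
theorem PhiDel_equiv (M : Matrix (Fin 3) (Fin 3) ℂ) (hM : IsUnitaryOf (starRingAut : ℂ ≃+* ℂ) J M)
    (y : Fin 3 → ℂ) (z : Fin 2 → ℂ) (hz : z ∈ ball) (l : Fin 2) :
    (∑ k : Fin 2, datumS PhiDel (M *ᵥ y) (actM M z) k * pd l (fun w => actM M w k) z) = datumS PhiDel y z l := by
  have hzM : actM M z ∈ ball := actM_mem_ball' M hM hz
  have hdiff : DifferentiableAt ℂ (actM M) z := differentiableAt_actM M (j_ne_zero M hM hz)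
  set u : (Fin 2 → ℂ) → ℂ := fun w => ((Real.exp (-Real.pi * maj (M *ᵥ y) w) : ℝ) : ℂ) with hu_def
  have hu : DifferentiableAt ℝ u (actM M z) := by
    have := (((hasFDerivAt_maj (M *ᵥ y) hzM).const_mul (-Real.pi)).exp)
    exact (Complex.ofRealCLM.hasFDerivAt.comp _ this).differentiableAt
  have hEq : u ∘ actM M =ᶠ[nhds z] fun w => ((Real.exp (-Real.pi * maj y w) : ℝ) : ℂ) := by
    filter_upwards [isOpen_ball'.mem_nhds hz] with w hw
    simp only [Function.comp, hu_def, maj_actM' M hM y hw]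
  symm
  calc datumS PhiDel y z l = wd l (fun w => ((Real.exp (-Real.pi * maj y w) : ℝ) : ℂ)) z := (wd_expMaj y hz l).symm
    _ = wd l (u ∘ actM M) z := by
        unfold wd
        rw [hEq.fderiv_eq]
    _ = ∑ k, wd k u (actM M z) * pd l (fun w => actM M w k) z := wd_comp u (actM M) z hdiff hu l
    _ = ∑ k : Fin 2, datumS PhiDel (M *ᵥ y) (actM M z) k * pd l (fun w => actM M w k) z := by
        refine Finset.sum_congr rfl fun k _ => ?_
        rw [hu_def, wd_expMaj (M *ᵥ y) hzM k]

end Summit.Ventures.HodgeRepro.Tier4.Line3
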